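import Summits.QuantumFields.YangMills.Theorems.FluctuationComparisonRegPrIntLS2BetaSlowDataNets
import Summits.QuantumFields.YangMills.Theorems.FluctuationComparisonRegPrIntLS2BetaAntipodalConeCentre
import HarnessLib

/-!
# S2β · D-GUARD ∕ (BG∞) — A CONE CENTRE FOR A SLOW TUBE ((B3′): ✓p840086 NETS ∘ ✓p839220 `exists_coneCentre_of_patched` over the FOUR `α`∕`β`-FACES of a
# box-block `{0..nα} × {0..nβ} × {0..nγ}` read as rectangular grids): per-bond tube oscillation `≤ δ` + two numeric side conditions ⟹ ONE centre `a` with every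
# tube datum inside the cap `‖logVec (a⁻¹·ψ (i,k,l))‖ ≤ π − r` — i.e. the ring-cap hypothesis of (R2)∕(R3) for EVERY slice `l` of the block AT ONCE (one `Wr`, one `a`
# per block, so that (R3)'s across-slice law compares slices under the same centre)

Cell `ym3-torus` (YM ladder rung R3 = continuum `SU(2)` Yang–Mills on the three-torus at fixed lattice data — a RUNG: NOT d = 4, NOT infinite volume,
NOT a mass gap, NOT Clay).  Width seat «width 5» `ym3-torus-px5` (gen 24), FREE px helper on crux `stmt-QuantumFields-20520` (`FluctuationComparisonRegPrIntL`;
registry `Lines/semiclassical_s2beta.lean` UNTOUCHED, 0∕5); `--kind proof --supports stmt-QuantumFields-20520 --as helper`, count-neutral, DEFINITION-FREE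
(0 `def`, 0 `instance`, 0 `notation`, 0 `sorry`, default heartbeats).

WHY.  Stage T of the 8-colour sections ((L-Σ), the one hypothesis `hSec` of ✓p840037) pins ONE rectangle operator `Wr` (hence ONE cone centre `a`) per class-2
block ((R3) `hW`), and (R3)'s laws ask, slice by slice, that the slice's RING data lie inside the cap of `a`; the union of the rings over all slices is the TUBE =
the block's two `α`-faces (`(nβ+1) × (nγ+1)` grids) and two `β`-faces (`(nα+1) × (nγ+1)` grids).  The tube data are slow in both grid directions (in-face: (L-I)'s
axial letter + transitions; along `γ`: (L-I)'s transverse letter + transitions), so ✓`exists_patch_of_grid` ×4 gives a net of `2(nβ∕m+1)(nγ∕m+1) +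
2(nα∕m+1)(nγ∕m+1)` points with patch radius `(π∕2)·2(m−1)·δ`, and ✓`exists_coneCentre_of_patched` returns the centre — `r`, `m∕ρ` absolute (§116.3, px17's ledger).

WHAT IS PROVED (sorry-free).
* `card_faces` — the cardinality of `((F₁ ⊕ F₁) ⊕ (F₂ ⊕ F₂))`, `Fᵢ := Fin Aᵢ × Fin B`, in `ℝ`.
* ★★★ `exists_tubeCentre (nα nβ nγ m) (hm : 1 ≤ m) (ψ : ℕ × ℕ × ℕ → SU2) (hδ) (hr0) (hrπ : 3r∕2 ≤ π) (hA) (hB) (hC) (hrad : π∕2·((2(m−1))·δ) ≤ r∕2)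
  (hcard : (2·((nβ∕m+1)·(nγ∕m+1)) + 2·((nα∕m+1)·(nγ∕m+1)))·(2∕(3π)·(3r∕2)³) < 1) :
  ∃ a, ∀ i k l, i ≤ nα → k ≤ nβ → l ≤ nγ → (i = 0 ∨ i = nα ∨ k = 0 ∨ k = nβ) → ‖logVec (su2Quat (a⁻¹·ψ (i, k, l)))‖ ≤ π − r`.

HONEST SCOPE.  Composition of landed bricks; no lattice, no gauge field; nothing of Bałaban's renormalisation-group analysis is asserted or proved ([Balaban1985RegularSpaces]
Thm 2 p.83 — local small gauges — is the consumer's context only).  `hSec` ∕ (BG∞) ∕ `hsupp⁺` are CONJECTURES (plan §116) and NOT proved; GAP♯∘ (registry UNTOUCHED),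
the five registered stubs (0∕5), S2β, 20520, 19936, 19200, `YM3TorusSU2` are NOT proved; no registered stub is closed; rung R3 — NOT d = 4, NOT infinite volume,
NOT a mass gap, NOT Clay; the Yang–Mills mass gap is NOT proved.  Axioms standard.

References: T. Bałaban, CMP **99** (1985) 75–102 [Balaban1985RegularSpaces] (Thm 2 p.83).
-/

set_option autoImplicit false

noncomputable section

namespace Summit.QuantumFields.YangMills.Theorems.FluctuationComparisonRegPrIntLS2BetaSlowTubeConeCentre

open scoped Real
open Literature.MathematicalPhysics.QuantumLattice (su2Quat)
open Literature.MathematicalPhysics.QuantumFieldTheory.Balaban1983to89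
open T4CubeChartGnomonic (SU2)
open T4ExpWindowSmallField (logVec)
open Summit.QuantumFields.YangMills.Theorems.FluctuationComparisonRegPrIntLS2BetaSlowDataNets (exists_patch_of_grid)
open Summit.QuantumFields.YangMills.Theorems.FluctuationComparisonRegPrIntLS2BetaAntipodalConeCentre (exists_coneCentre_of_patched)

/-- The cardinality of the four-faces index type. [folklore] -/
theorem card_faces (A₁ A₂ B : ℕ) :
    (Fintype.card (((Fin A₁ × Fin B) ⊕ (Fin A₁ × Fin B)) ⊕ ((Fin A₂ × Fin B) ⊕ (Fin A₂ × Fin B))) : ℝ) = ((2 * (A₁ * B) + 2 * (A₂ * B) : ℕ) : ℝ) := by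
  have h : Fintype.card (((Fin A₁ × Fin B) ⊕ (Fin A₁ × Fin B)) ⊕ ((Fin A₂ × Fin B) ⊕ (Fin A₂ × Fin B))) = 2 * (A₁ * B) + 2 * (A₂ * B) := by
    simp only [Fintype.card_sum, Fintype.card_prod, Fintype.card_fin]; ring
  rw [h]

/-- ★★★ **A CONE CENTRE FOR A SLOW TUBE**: data `ψ` on the four `α`∕`β`-faces of the box `{0..nα} × {0..nβ} × {0..nγ}` with per-bond oscillation `dist1 ≤ δ` along the
bonds lying in those faces (`α`-bonds in the `β`-faces, `β`-bonds in the `α`-faces, `γ`-bonds anywhere on the tube), a subsampling step `m ≥ 1` with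
`(π∕2)·2(m−1)·δ ≤ r∕2`, and the packing count `< 1` admit ONE centre `a` with every tube datum inside the cap `‖logVec (a⁻¹·ψ (i,k,l))‖ ≤ π − r` — the ring cap of
every `(α, β)`-slice of the block. [cite: Balaban1985RegularSpaces, Thm 2 p.83] -/
theorem exists_tubeCentre (nα nβ nγ m : ℕ) (hm : 1 ≤ m) (ψ : ℕ × ℕ × ℕ → SU2) {δ r : ℝ} (hδ : 0 ≤ δ) (hr0 : 0 ≤ r) (hrπ : 3 * r / 2 ≤ π)
    (hA : ∀ i k l, i + 1 ≤ nα → (k = 0 ∨ k = nβ) → l ≤ nγ → dist1 (ψ (i, k, l) * (ψ (i + 1, k, l))⁻¹) ≤ δ)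
    (hB : ∀ i k l, (i = 0 ∨ i = nα) → k + 1 ≤ nβ → l ≤ nγ → dist1 (ψ (i, k, l) * (ψ (i, k + 1, l))⁻¹) ≤ δ)
    (hC : ∀ i k l, i ≤ nα → k ≤ nβ → (i = 0 ∨ i = nα ∨ k = 0 ∨ k = nβ) → l + 1 ≤ nγ → dist1 (ψ (i, k, l) * (ψ (i, k, l + 1))⁻¹) ≤ δ)
    (hrad : π / 2 * (((2 * (m - 1) : ℕ) : ℝ) * δ) ≤ r / 2)
    (hcard : ((2 * ((nβ / m + 1) * (nγ / m + 1)) + 2 * ((nα / m + 1) * (nγ / m + 1)) : ℕ) : ℝ) * (2 / (3 * π) * (3 * r / 2) ^ 3) < 1) :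
    ∃ a : SU2, ∀ i k l, i ≤ nα → k ≤ nβ → l ≤ nγ → (i = 0 ∨ i = nα ∨ k = 0 ∨ k = nβ) →
      ‖logVec (su2Quat (a⁻¹ * ψ (i, k, l)))‖ ≤ π - r := by
  -- the four faces as slow grids, subsampled every `m` steps in both directions
  have hF0 := exists_patch_of_grid (fun k l => ψ (0, k, l)) nβ nγ hδ
    (fun k l hk hl => hB 0 k l (Or.inl rfl) hk hl) (fun k l hk hl => hC 0 k l (Nat.zero_le _) (by omega) (Or.inl rfl) hl) m hm
  have hF1 := exists_patch_of_grid (fun k l => ψ (nα, k, l)) nβ nγ hδ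
    (fun k l hk hl => hB nα k l (Or.inr rfl) hk hl) (fun k l hk hl => hC nα k l le_rfl (by omega) (Or.inr (Or.inl rfl)) hl) m hm
  have hG0 := exists_patch_of_grid (fun i l => ψ (i, 0, l)) nα nγ hδ
    (fun i l hi hl => hA i 0 l hi (Or.inl rfl) hl) (fun i l hi hl => hC i 0 l hi (Nat.zero_le _) (Or.inr (Or.inr (Or.inl rfl))) hl) m hm
  have hG1 := exists_patch_of_grid (fun i l => ψ (i, nβ, l)) nα nγ hδ
    (fun i l hi hl => hA i nβ l hi (Or.inr rfl) hl) (fun i l hi hl => hC i nβ l hi le_rfl (Or.inr (Or.inr (Or.inr rfl))) hl) m hm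
  obtain ⟨a, ha⟩ := exists_coneCentre_of_patched
    (ι := ((Fin (nβ / m + 1) × Fin (nγ / m + 1)) ⊕ (Fin (nβ / m + 1) × Fin (nγ / m + 1))) ⊕
      ((Fin (nα / m + 1) × Fin (nγ / m + 1)) ⊕ (Fin (nα / m + 1) × Fin (nγ / m + 1))))
    (Sum.elim
      (Sum.elim (fun q => ψ (0, m * (q.1 : ℕ), m * (q.2 : ℕ))) (fun q => ψ (nα, m * (q.1 : ℕ), m * (q.2 : ℕ))))
      (Sum.elim (fun q => ψ (m * (q.1 : ℕ), 0, m * (q.2 : ℕ))) (fun q => ψ (m * (q.1 : ℕ), nβ, m * (q.2 : ℕ)))))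
    (Sum.elim
      (Sum.elim (fun p : Fin (nβ + 1) × Fin (nγ + 1) => ψ (0, (p.1 : ℕ), (p.2 : ℕ)))
        (fun p : Fin (nβ + 1) × Fin (nγ + 1) => ψ (nα, (p.1 : ℕ), (p.2 : ℕ))))
      (Sum.elim (fun p : Fin (nα + 1) × Fin (nγ + 1) => ψ ((p.1 : ℕ), 0, (p.2 : ℕ)))
        (fun p : Fin (nα + 1) × Fin (nγ + 1) => ψ ((p.1 : ℕ), nβ, (p.2 : ℕ)))))
    hr0 hrπ
    (by
      rintro ((p | p) | (p | p))
      · obtain ⟨q, hq⟩ := hF0 p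
        exact ⟨Sum.inl (Sum.inl q), by simpa using hq.trans hrad⟩
      · obtain ⟨q, hq⟩ := hF1 p
        exact ⟨Sum.inl (Sum.inr q), by simpa using hq.trans hrad⟩
      · obtain ⟨q, hq⟩ := hG0 p
        exact ⟨Sum.inr (Sum.inl q), by simpa using hq.trans hrad⟩
      · obtain ⟨q, hq⟩ := hG1 p
        exact ⟨Sum.inr (Sum.inr q), by simpa using hq.trans hrad⟩)
    (by rw [card_faces]; exact hcard)
  refine ⟨a, fun i k l hi hk hl hb => ?_⟩
  rcases hb with h | h | h | h
  · have h1 := ha (Sum.inl (Sum.inl (⟨k, Nat.lt_succ_of_le hk⟩, ⟨l, Nat.lt_succ_of_le hl⟩)))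
    rw [h]; simpa using h1
  · have h1 := ha (Sum.inl (Sum.inr (⟨k, Nat.lt_succ_of_le hk⟩, ⟨l, Nat.lt_succ_of_le hl⟩)))
    rw [h]; simpa using h1
  · have h1 := ha (Sum.inr (Sum.inl (⟨i, Nat.lt_succ_of_le hi⟩, ⟨l, Nat.lt_succ_of_le hl⟩)))
    rw [h]; simpa using h1
  · have h1 := ha (Sum.inr (Sum.inr (⟨i, Nat.lt_succ_of_le hi⟩, ⟨l, Nat.lt_succ_of_le hl⟩)))
    rw [h]; simpa using h1

end Summit.QuantumFields.YangMills.Theorems.FluctuationComparisonRegPrIntLS2BetaSlowTubeConeCentre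

end
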